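import Literature.Probability.LatticeModels.PlanarIsing
import HarnessLib

/-!
# The CHI one-point function: the approximation hypothesis, the `ϱ(δ)`-normalised theorem and a
corrected form of `chi_halfplane_onePoint`

`Literature.Probability.LatticeModels.PlanarIsing` states, as the named fact
`Literature.Probability.LatticeModels.chi_halfplane_onePoint`, the explicit one-point function of the critical planar
Ising model with `+` boundary conditions (Chelkak–Hongler–Izyurov, *Conformal invariance of spin
correlations in the planar Ising model*, Ann. of Math. 181 (2015) 1087–1138 = arXiv:1202.2838
(CHI), Thm 1.3 with `k = 0`, eqs. (1.2)–(1.3), and the display on p. 3 of the introduction: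
`δ^{-1/8} 𝔼⁺_{Ω_δ}[σ_a] → 𝒞₁ · rad(a, Ω)^{-1/8}` "as `Ω_δ` approximates `Ω`").

## The discrepancy (why `chi_halfplane_onePoint` is not discharged here)

Every theorem of CHI carries the standing hypothesis (CHI §2, p. 13 of the arXiv version): *the
family of (simply connected, §2.1) discrete domains `Ω_δ` approximates `Ω`, i.e. `∂Ω_δ → ∂Ω` in
the Hausdorff sense* (or at least in the Carathéodory sense). The tree's fact
`chi_halfplane_onePoint` instead quantifies over **all** admissible `Ω` with the **fixed**
discretisation scheme `meshDomain Ω δ` of `DomainDiscretisation.lean`, whose mesh graph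
`meshGraph Ω δ` joins two neighbouring sites iff the closed segment between them lies in the
**closure** `Ω̄`. A slit of `Ω` (a boundary arc entering the domain) lies in `Ω̄`, so it is
invisible to `meshGraph`; if moreover no mesh point ever lies on the slit (a slit on a ray of
irrational slope emanating from `0` but stopping short of the centre `0`, which is a mesh point at
every scale), then for *every* `δ` all discrete data of `Ω` and of the unslit domain
`Ω'` coincide, hence `chiPlusCorr Ω = chiPlusCorr Ω'`, while the right-hand side
`𝒞 · rad(a, Ω)^{-1/8}` of `chi_halfplane_onePoint` distinguishes `Ω` from `Ω'`. So the fact as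
written is false: the sibling file `PlanarIsingSlitDisc.lean` proves `¬ chi_halfplane_onePoint`
(`Literature.Probability.LatticeModels.not_chi_halfplane_onePoint`, slit unit disc versus unit disc, both with explicit
uniformising maps). The defect is the missing approximation hypothesis, not CHI's theorem; for
such `Ω` the hypothesis `MeshApproximates Ω` below fails (the discrete boundary never approaches
the slit).

## Contents

* `meshCell`, `meshPolygon`: the closed square face of side `δ` around a mesh point and the
  polygonal domain of a set of sites (CHI §2.1: "we call discrete domain a union of grid faces;
  `Ω_δ` is simply connected if the corresponding polygonal domain is simply connected").
* `MeshApproximates Ω`: CHI's standing hypothesis for the tree's scheme — eventually (as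
  `δ → 0⁺`) the polygonal domain `P_δ` of the free sites `meshInteriorFinset Ω δ` is simply
  connected, `∂P_δ → ∂Ω` in Hausdorff distance, and every compact `K ⊆ Ω` is eventually inside
  `P_δ` (the bulk condition implicit in CHI's "uniformly over all `a ∈ Ω` at distance `≥ ε` from
  `∂Ω`", which presupposes that such `a` are faces of `Ω_δ`).
* `rhoCHI δ`: CHI's normalising factor `ϱ(δ) = 𝔼_{ℂ_δ}[σ_0 σ_1]`, the full-plane critical
  two-point function at Euclidean distance `≈ 1` in a lattice-diagonal direction, transported to
  the tree's axis-parallel lattice `δℤ²` (CHI's face lattice is `δℤ²` rotated by `45°`).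
* Named facts `chi_onePoint_rho` (CHI Thm 1.3, `k = 0`, with (1.2)–(1.3)) and `wu_rhoCHI`
  (CHI Remark 1.2 (iii), after T. T. Wu, Phys. Rev. 149 (1966) 380: `ϱ(δ) ∼ 𝒞₂ δ^{1/4}`).
* `chi_halfplane_onePoint_hausdorff`: the corrected statement (same conclusion as
  `chi_halfplane_onePoint`, under the extra hypothesis `MeshApproximates Ω`), **proved** from the
  two named facts (`chi_halfplane_onePoint_hausdorff_of`).
* The multi-point statement (appended 2026-08-14; bookkeeping revised 2026-08-15): the named
  fact `chi_multiPoint_rho` (CHI Thm 1.3 for all `k`, `ϱ`-normalised, with the covariance (1.2)),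
  and the corrected form `chi_conformal_invariance_hausdorff` of
  `Literature.Probability.LatticeModels.chi_conformal_invariance` (extra hypothesis
  `MeshApproximates Ω` in the convergence clause), which is a **theorem** with the two named facts
  `chi_multiPoint_rho` and `wu_rhoCHI` as hypotheses (it is the `δ^{-n/8}`-normalised corollary
  CHI print on p. 3, "our result … when combined with the asymptotics of the two-point
  correlations in the plane", not a separately published result; until 2026-08-15 it was a
  named fact `def … : Prop` with the same statement plus a glue theorem
  `chi_conformal_invariance_hausdorff_of`, i.e. one redundant unit of unproved debt — merged under
  the D-0026 split review), together with its consequences for the limit family `chiPlusCorr`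
  between approximable domains (`tendsto_chiPlusCorr_of_hausdorff`,
  `chiPlusCorr_covariant_of_hausdorff` — the corrected forms of `tendsto_chiPlusCorr` and
  `isConformallyCovariant_chiPlusCorr` of `PlanarIsing.lean`, whose Erratum explains why the
  unrestricted forms are not consequences of CHI — now likewise over the two named facts).

* `wu_rhoCHI_of_tendsto_diag` (appended 2026-08-15, D-0026 split review of `wu_rhoCHI`): the
  fact `wu_rhoCHI` in its `δ`-form FOLLOWS from Wu's theorem in its printed lattice form
  `N^{1/4} ⟨σ_{(0,0)} σ_{(N,N)}⟩⁺_{β_c(2)} → A > 0` (McCoy–Wu 1973, Ch. XI; the hypothesis is kept a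
  hypothesis, no new named fact), with `C₂ = (√2/2)^{-1/4} A`: the interface through which an
  exact-solution derivation of the critical *diagonal* two-point function discharges `wu_rhoCHI`.

Lattice bookkeeping (CHI §1.1, §2.1). CHI work on the faces of the square grid
`ℂ_η = η(1 + i)ℤ²` rotated by `45°`, "of diagonal mesh size `2η`", adjacent spins (face centres)
being at distance `√2 η`; the similarity `z ↦ e^{iπ/4} z + η` maps the tree's lattice `δℤ²`,
`δ = √2 η`, onto CHI's face lattice, and the tree's `+` measure in the volume
`meshInteriorFinset Ω δ` (all spins outside frozen to `+1`, every lattice edge at a free site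
interacting) is CHI's model on the discrete domain whose set of faces is that volume. CHI's
theorems are normalised by `ϱ`, which is scale-free, so no constant changes in `chi_onePoint_rho`;
in `wu_rhoCHI` the constant is existential (CHI print `𝒞₂ = 2^{1/3} e^{-3ζ'(-1)}` for `η`).

## References

* D. Chelkak, C. Hongler, K. Izyurov, *Conformal invariance of spin correlations in the planar
  Ising model*, Ann. of Math. (2) 181 (2015), 1087–1138; arXiv:1202.2838. Thms 1.1, 1.3,
  Remark 1.2, eqs. (1.1)–(1.3), §2.1, §2 (p. 13) conventions.
* T. T. Wu, *Theory of Toeplitz determinants and the spin correlations of the two-dimensional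
  Ising model. I*, Phys. Rev. 149 (1966), 380–401.
-/

noncomputable section

open MeasureTheory Filter Topology Real
open Literature.Probability.LatticeModels

namespace Literature.Probability.LatticeModels

/-! ### Discrete domains as polygons; CHI's approximation hypothesis -/

/-- The closed square face of side `δ` of the dual lattice centred at the mesh point `δx`,
`{z | |Re z - δ x₀| ≤ δ/2, |Im z - δ x₁| ≤ δ/2}` (CHI identify faces with their centres, §2.1).
[cite: ChelkakHonglerIzyurovAnnals2015, §2.1] -/
def meshCell (δ : ℝ) (x : Site 2) : Set ℂ :=
  {z | |z.re - δ * x 0| ≤ δ / 2 ∧ |z.im - δ * x 1| ≤ δ / 2}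

/-- The mesh point `δx` lies in its own cell (for `δ ≥ 0`). [cite: ChelkakHonglerIzyurovAnnals2015, §2.1] -/
theorem meshPoint_mem_meshCell {δ : ℝ} (hδ : 0 ≤ δ) (x : Site 2) : meshPoint δ x ∈ meshCell δ x := by
  constructor <;> simp [meshPoint_re, meshPoint_im] <;> positivity

/-- The polygonal domain of a set `Λ` of sites at mesh `δ`: the interior of the union of the closed
faces of `Λ` (CHI §2.1: "we call discrete domain of mesh size `δ` a union of grid faces; we say
that `Ω_δ` is simply connected if the corresponding polygonal domain is simply connected").
[cite: ChelkakHonglerIzyurovAnnals2015, §2.1] -/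
def meshPolygon (Λ : Set (Site 2)) (δ : ℝ) : Set ℂ :=
  interior (⋃ x ∈ Λ, meshCell δ x)

/-- The polygonal domain is open. [cite: ChelkakHonglerIzyurovAnnals2015, §2.1] -/
theorem isOpen_meshPolygon (Λ : Set (Site 2)) (δ : ℝ) : IsOpen (meshPolygon Λ δ) :=
  isOpen_interior

/-- The polygonal domain `P_δ(Ω)` of the tree's `+`-boundary-condition volume: the polygon of the
free sites `meshInteriorFinset Ω δ = Ω_δ ∖ ∂Ω_δ` (the faces carrying unfrozen spins, CHI's
`Int 𝒱°_{Ω_δ}`). [cite: ChelkakHonglerIzyurovAnnals2015, §2.1] -/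
def meshInteriorPolygon (Ω : Set ℂ) (δ : ℝ) : Set ℂ :=
  meshPolygon (meshInteriorFinset Ω δ : Set (Site 2)) δ

/-- **CHI's standing approximation hypothesis**, for the tree's discretisation scheme. CHI prove
their theorems for families of simply connected discrete domains `Ω_δ` (§2.1) that *approximate*
`Ω`: "`∂Ω_δ` converges to `∂Ω` in the Hausdorff sense" (§2, conventions, p. 13 of
arXiv:1202.2838; "our proofs can be easily generalized for the Carathéodory convergence"), the
marked points `a ∈ Ω` at distance `≥ ε` from `∂Ω` being faces of `Ω_δ` (Thms 1.1, 1.3). For the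
fixed scheme `Ω ↦ meshInteriorFinset Ω δ` this is a **property of `Ω`**: as `δ → 0⁺`,
eventually the polygonal domain `P_δ = meshInteriorPolygon Ω δ` is simply connected (Mathlib's
`IsSimplyConnected`, which includes nonempty and path connected), the Hausdorff distance between
`∂P_δ` and `∂Ω` tends to `0`, and every compact `K ⊆ Ω` is eventually contained in `P_δ`.
It fails, e.g., for a disc slit along a segment of a ray of irrational slope emanating from (but
avoiding) its centre, as in `PlanarIsingSlitDisc.lean` (no mesh point lies on the slit and every
mesh edge crossing it stays in `Ω̄`, so the slit is never resolved).
(CHI additionally assume, "to simplify the presentation", that `Ω_δ` has no fiords of one face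
width, an assumption they state "can be easily relaxed".)
[cite: ChelkakHonglerIzyurovAnnals2015, §2.1 and §2 conventions (Hausdorff approximation)] -/
def MeshApproximates (Ω : Set ℂ) : Prop :=
  (∀ᶠ δ in 𝓝[>] (0 : ℝ), IsSimplyConnected (meshInteriorPolygon Ω δ)) ∧
    Tendsto (fun δ => Metric.hausdorffDist (frontier (meshInteriorPolygon Ω δ)) (frontier Ω))
      (𝓝[>] 0) (𝓝 0) ∧
    ∀ K, IsCompact K → K ⊆ Ω → ∀ᶠ δ in 𝓝[>] (0 : ℝ), K ⊆ meshInteriorPolygon Ω δ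

/-! ### CHI's normalising factor `ϱ(δ)` and the two named facts -/

/-- CHI's normalising factor `ϱ(δ) := 𝔼_{ℂ_δ}[σ_{0_δ} σ_{1_δ}]` (CHI §1.1): the critical
full-plane (unique infinite-volume, here: plus-state, `twoPointPlus`) two-point function between
the sites approximating two points at Euclidean distance `1` in a *lattice-diagonal* direction
(CHI's points `0, 1 ∈ ℂ` are diagonal neighbours-at-distance-`1/δ` of their `45°`-rotated face
lattice; on the tree's axis-parallel lattice `δℤ²` this is the pair `0`, `[e^{iπ/4}/δ]`, and by
the reflection symmetry of `ℤ²` the choice of diagonal is immaterial). Junk for `δ ≤ 0` (then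
`nearestSite` is junk). [cite: ChelkakHonglerIzyurovAnnals2015, §1.1 (definition of ϱ(δ))] -/
def rhoCHI (δ : ℝ) : ℝ :=
  twoPointPlus 2 criticalBetaTwo (nearestSite δ ⟨Real.sqrt 2 / 2, Real.sqrt 2 / 2⟩)

/-- **CHI Theorem 1.3 for `k = 0`** (one-point function, `ϱ`-normalised, with the covariance
(1.2) and the half-plane value (1.3) `⟨σ_a⟩⁺_ℍ = 2^{1/4} (2 Im a)^{-1/8}` substituted): for a
bounded simply connected `Ω` whose discretisations approximate it (`MeshApproximates Ω`), every
conformal bijection `φ : Ω → ℍ` and every `a ∈ Ω`,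
`ϱ(δ)^{-1/2} · 𝔼⁺_{Ω_δ}[σ_a] → ⟨σ_a⟩⁺_Ω = ⟨σ_{φ a}⟩⁺_ℍ · |φ'(a)|^{1/8}
  = 2^{1/4} · |φ'(a)|^{1/8} · (2 Im φ(a))^{-1/8}` as `δ → 0⁺`.
(CHI state uniformity over `a` at distance `≥ ε` from `∂Ω`; only the pointwise statement is
vendored. The `ϱ`-normalisation is scale-free, so the transport from CHI's rotated face lattice
to `δℤ²` changes no constant.) [cite: ChelkakHonglerIzyurovAnnals2015, Thm. 1.3 (k = 0) with eqs. (1.2)–(1.3)] -/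
def chi_onePoint_rho : Prop :=
  ∀ (Ω : Set ℂ), IsAdmissibleDomain Ω → MeshApproximates Ω → ∀ (φ : ℂ → ℂ),
    IsConformalBijection φ Ω UpperHalfPlane.upperHalfPlaneSet → ∀ a ∈ Ω,
      Tendsto (fun δ => rhoCHI δ ^ (-(1 : ℝ) / 2) * meshIsingPlusCorr Ω δ ![a]) (𝓝[>] 0)
        (𝓝 ((2 : ℝ) ^ ((1 : ℝ) / 4) * ‖deriv φ a‖ ^ ((1 : ℝ) / 8) *
          (2 * (φ a).im) ^ (-(1 : ℝ) / 8)))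

/-- **Wu's asymptotics of the critical diagonal two-point function**, in the form quoted by CHI,
Remark 1.2 (iii): `ϱ(η) ∼ 𝒞₂ · η^{1/4}` as `η → 0`, `𝒞₂ = 2^{1/3} e^{-3ζ'(-1)}` (T. T. Wu, Phys.
Rev. 149 (1966) 380; McCoy–Wu, *The two-dimensional Ising model* (1973), Ch. XI). In the tree's
mesh normalisation `δ = √2 η` this reads `δ^{-1/4} ϱ(δ) → 2^{-1/8} 𝒞₂ > 0`; the constant is
vendored existentially. (CHI: "we do not need this result in our proofs" — it is needed exactly to
pass from the `ϱ`-normalisation of Thm 1.3 to the `δ^{-1/8}`-normalisation of `chiPlusCorr`.)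
[cite: ChelkakHonglerIzyurovAnnals2015, Remark 1.2 (iii); Wu1966] -/
def wu_rhoCHI : Prop :=
  ∃ C₂ : ℝ, 0 < C₂ ∧ Tendsto (fun δ => δ ^ (-(1 : ℝ) / 4) * rhoCHI δ) (𝓝[>] 0) (𝓝 C₂)

/-! ### The corrected one-point statement and its derivation -/

/-- **crit-ising.S14** (corrected form of `chi_halfplane_onePoint`: explicit one-point function;
CHI Thm 1.3 (`k = 0`) with eqs. (1.2)–(1.3) and Remark 1.2 (iii), i.e. the display of CHI p. 3:
`δ^{-1/8} 𝔼⁺_{Ω_δ}[σ_a] → 𝒞₁ rad(a, Ω)^{-1/8}` "as `Ω_δ` approximates `Ω`"). There is one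
constant `𝒞 > 0` such that for every admissible `Ω` **whose discretisations approximate it in
CHI's sense** (`MeshApproximates Ω` — this hypothesis is what `chi_halfplane_onePoint` omits;
without it the statement is false, `not_chi_halfplane_onePoint` in `PlanarIsingSlitDisc.lean`),
every conformal bijection `φ : Ω → ℍ` and every `a ∈ Ω`,
`lim_{δ → 0⁺} δ^{-1/8} 𝔼⁺_{Ω_δ}[σ_a] = 𝒞 · |φ'(a)|^{1/8} · (2 Im φ(a))^{-1/8}`
(`= 𝒞 · rad(a, Ω)^{-1/8}`). Proved below from `chi_onePoint_rho` and `wu_rhoCHI`.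
[cite: ChelkakHonglerIzyurovAnnals2015, Thm. 1.3 (k = 0), eqs. (1.2)–(1.3), Rem. 1.2 (iii)] -/
def chi_halfplane_onePoint_hausdorff : Prop :=
  ∃ C : ℝ, 0 < C ∧ ∀ (Ω : Set ℂ) (φ : ℂ → ℂ), IsAdmissibleDomain Ω → MeshApproximates Ω →
      IsConformalBijection φ Ω UpperHalfPlane.upperHalfPlaneSet → ∀ a ∈ Ω,
        chiPlusCorr Ω 1 ![a] =
          C * ‖deriv φ a‖ ^ ((1 : ℝ) / 8) * (2 * (φ a).im) ^ (-(1 : ℝ) / 8)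

/-- Under CHI Thm 1.3 (`k = 0`) and Wu's asymptotics the renormalised one-point function
converges: `δ^{-1/8} 𝔼⁺_{Ω_δ}[σ_a] → 2^{1/4} C₂^{1/2} · |φ'(a)|^{1/8} (2 Im φ a)^{-1/8}`, where
`C₂ = lim δ^{-1/4} ϱ(δ)`. (CHI, p. 3: "our result for magnetization, when combined with the
asymptotics of the two-point correlations in the plane, reads as follows".)
[cite: ChelkakHonglerIzyurovAnnals2015, §1 (p. 3 display) from Thm. 1.3 and Rem. 1.2 (iii)] -/
theorem tendsto_onePoint_of_rho {Ω : Set ℂ} {φ : ℂ → ℂ} {a : ℂ} {C₂ : ℝ}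
    (h₁ : Tendsto (fun δ => rhoCHI δ ^ (-(1 : ℝ) / 2) * meshIsingPlusCorr Ω δ ![a]) (𝓝[>] 0)
        (𝓝 ((2 : ℝ) ^ ((1 : ℝ) / 4) * ‖deriv φ a‖ ^ ((1 : ℝ) / 8) *
          (2 * (φ a).im) ^ (-(1 : ℝ) / 8))))
    (hC₂ : 0 < C₂) (h₂ : Tendsto (fun δ => δ ^ (-(1 : ℝ) / 4) * rhoCHI δ) (𝓝[>] 0) (𝓝 C₂)) :
    Tendsto (fun δ => δ ^ (-(1 : ℝ) / 8) * meshIsingPlusCorr Ω δ ![a]) (𝓝[>] 0)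
      (𝓝 ((2 : ℝ) ^ ((1 : ℝ) / 4) * C₂ ^ ((1 : ℝ) / 2) * ‖deriv φ a‖ ^ ((1 : ℝ) / 8) *
          (2 * (φ a).im) ^ (-(1 : ℝ) / 8))) := by
  -- eventually `ϱ(δ) > 0`
  have hpos : ∀ᶠ δ in 𝓝[>] (0 : ℝ), 0 < rhoCHI δ := by
    filter_upwards [h₂.eventually (lt_mem_nhds hC₂), self_mem_nhdsWithin] with δ hδ hδ0
    have hδ0' : 0 < δ ^ (-(1 : ℝ) / 4) := Real.rpow_pos_of_pos hδ0 _
    exact pos_of_mul_pos_right hδ hδ0'.le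
  have h₃ : Tendsto (fun δ => (δ ^ (-(1 : ℝ) / 4) * rhoCHI δ) ^ ((1 : ℝ) / 2)) (𝓝[>] 0)
      (𝓝 (C₂ ^ ((1 : ℝ) / 2))) :=
    h₂.rpow_const (Or.inr (by norm_num))
  have h₄ := h₁.mul h₃
  have key : (fun δ => rhoCHI δ ^ (-(1 : ℝ) / 2) * meshIsingPlusCorr Ω δ ![a] *
      (δ ^ (-(1 : ℝ) / 4) * rhoCHI δ) ^ ((1 : ℝ) / 2)) =ᶠ[𝓝[>] 0]
      fun δ => δ ^ (-(1 : ℝ) / 8) * meshIsingPlusCorr Ω δ ![a] := by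
    filter_upwards [hpos, self_mem_nhdsWithin] with δ hρ hδ
    have hδ' : (0 : ℝ) < δ := hδ
    rw [Real.mul_rpow (Real.rpow_nonneg hδ'.le _) hρ.le, ← Real.rpow_mul hδ'.le]
    have h1 : rhoCHI δ ^ (-(1 : ℝ) / 2) * rhoCHI δ ^ ((1 : ℝ) / 2) = 1 := by
      rw [← Real.rpow_add hρ]; norm_num
    have h2 : (-(1 : ℝ) / 4) * ((1 : ℝ) / 2) = -(1 : ℝ) / 8 := by norm_num
    rw [h2]
    calc rhoCHI δ ^ (-(1 : ℝ) / 2) * meshIsingPlusCorr Ω δ ![a] *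
          (δ ^ (-(1 : ℝ) / 8) * rhoCHI δ ^ ((1 : ℝ) / 2))
        = (rhoCHI δ ^ (-(1 : ℝ) / 2) * rhoCHI δ ^ ((1 : ℝ) / 2)) *
            (δ ^ (-(1 : ℝ) / 8) * meshIsingPlusCorr Ω δ ![a]) := by ring
      _ = δ ^ (-(1 : ℝ) / 8) * meshIsingPlusCorr Ω δ ![a] := by rw [h1, one_mul]
  have h₅ := h₄.congr' key
  convert h₅ using 2
  ring

/-- **The corrected one-point statement holds** given CHI Thm 1.3 (`k = 0`) and Wu's asymptotics:
`chi_onePoint_rho → wu_rhoCHI → chi_halfplane_onePoint_hausdorff`, with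
`𝒞 = 2^{1/4} · C₂^{1/2}`. [cite: ChelkakHonglerIzyurovAnnals2015, Thm. 1.3 (k = 0), eqs. (1.2)–(1.3), Rem. 1.2 (iii)] -/
theorem chi_halfplane_onePoint_hausdorff_of (h₁ : chi_onePoint_rho) (h₂ : wu_rhoCHI) :
    chi_halfplane_onePoint_hausdorff := by
  obtain ⟨C₂, hC₂, hρ⟩ := h₂
  refine ⟨(2 : ℝ) ^ ((1 : ℝ) / 4) * C₂ ^ ((1 : ℝ) / 2), by positivity, ?_⟩
  intro Ω φ hΩ hM hφ a ha
  have h := tendsto_onePoint_of_rho (h₁ Ω hΩ hM φ hφ a ha) hC₂ hρ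
  unfold chiPlusCorr
  simp only [Nat.cast_one]
  exact h.limUnder_eq

/-! ### The multi-point statement: CHI Theorem 1.3 for all `k`, and the corrected form of
`chi_conformal_invariance` -/

/-- **CHI Theorem 1.3** (all `k`; `ϱ`-normalised, with the covariance (1.2)): there is a family of
continuum correlation functions `⟨σ_{a₁} ⋯ σ_{aₙ}⟩⁺_Ω`, conformally covariant with exponent `1/8`
under conformal maps between (bounded simply connected) domains — CHI (1.2):
`⟨σ_{a₀}⋯σ_{a_k}⟩⁺_Ω = ⟨σ_{φ(a₀)}⋯σ_{φ(a_k)}⟩⁺_{Ω'} · ∏ⱼ |φ'(aⱼ)|^{1/8}` — such that for every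
bounded simply connected `Ω` whose discretisations approximate it (`MeshApproximates Ω`, CHI §2
p. 13) and all distinct `a₁, …, aₙ ∈ Ω`,
`ϱ(δ)^{-n/2} · 𝔼⁺_{Ω_δ}[σ_{a₁} ⋯ σ_{aₙ}] → ⟨σ_{a₁} ⋯ σ_{aₙ}⟩⁺_Ω` as `δ → 0⁺`
(CHI: "uniformly over all `a₀, …, a_k ∈ Ω` at distance at least `ε` from `∂Ω` and from each other";
only the pointwise statement is vendored; `n = 0` is the trivial empty product `1 → 1`, included for
uniformity; the `ϱ`-normalisation is scale-free, so the transport from CHI's rotated face lattice to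
`δℤ²` changes no constant, cf. the module docstring). The values of the family outside admissible
domains are unconstrained. [cite: ChelkakHonglerIzyurovAnnals2015, Thm. 1.3 with eq. (1.2)] -/
def chi_multiPoint_rho : Prop :=
  ∃ S : PlanarCorrFamily, IsConformallyCovariant (1 / 8) S ∧
    ∀ (Ω : Set ℂ), IsAdmissibleDomain Ω → MeshApproximates Ω → ∀ (n : ℕ) (a : Fin n → ℂ),
      Function.Injective a → (∀ i, a i ∈ Ω) →
        Tendsto (fun δ => rhoCHI δ ^ (-(n : ℝ) / 2) * meshIsingPlusCorr Ω δ a) (𝓝[>] 0)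
          (𝓝 (S Ω n a))

/-- From the `ϱ`-normalisation to the `δ^{-n/8}`-normalisation, `n` points: if
`ϱ(δ)^{-n/2} 𝔼⁺_{Ω_δ}[σ_{a₁}⋯σ_{aₙ}] → L` and `δ^{-1/4} ϱ(δ) → C₂ > 0`, then
`δ^{-n/8} 𝔼⁺_{Ω_δ}[σ_{a₁}⋯σ_{aₙ}] → (C₂^{1/2})ⁿ · L` (CHI p. 3: Thm 1.3 "combined with the
asymptotics of the two-point correlations in the plane").
[cite: ChelkakHonglerIzyurovAnnals2015, §1 (p. 3 display) from Thm. 1.3 and Rem. 1.2 (iii)] -/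
theorem tendsto_multiPoint_of_rho {Ω : Set ℂ} {n : ℕ} {a : Fin n → ℂ} {L C₂ : ℝ}
    (h₁ : Tendsto (fun δ => rhoCHI δ ^ (-(n : ℝ) / 2) * meshIsingPlusCorr Ω δ a) (𝓝[>] 0) (𝓝 L))
    (hC₂ : 0 < C₂) (h₂ : Tendsto (fun δ => δ ^ (-(1 : ℝ) / 4) * rhoCHI δ) (𝓝[>] 0) (𝓝 C₂)) :
    Tendsto (fun δ => δ ^ (-(n : ℝ) / 8) * meshIsingPlusCorr Ω δ a) (𝓝[>] 0)
      (𝓝 ((C₂ ^ ((1 : ℝ) / 2)) ^ n * L)) := by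
  -- eventually `ϱ(δ) > 0`
  have hpos : ∀ᶠ δ in 𝓝[>] (0 : ℝ), 0 < rhoCHI δ := by
    filter_upwards [h₂.eventually (lt_mem_nhds hC₂), self_mem_nhdsWithin] with δ hδ hδ0
    have hδ0' : 0 < δ ^ (-(1 : ℝ) / 4) := Real.rpow_pos_of_pos hδ0 _
    exact pos_of_mul_pos_right hδ hδ0'.le
  have h₃ : Tendsto (fun δ => (δ ^ (-(1 : ℝ) / 4) * rhoCHI δ) ^ ((n : ℝ) / 2)) (𝓝[>] 0)
      (𝓝 (C₂ ^ ((n : ℝ) / 2))) :=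
    h₂.rpow_const (Or.inr (by positivity))
  have h₄ := h₃.mul h₁
  have key : (fun δ => (δ ^ (-(1 : ℝ) / 4) * rhoCHI δ) ^ ((n : ℝ) / 2) *
      (rhoCHI δ ^ (-(n : ℝ) / 2) * meshIsingPlusCorr Ω δ a)) =ᶠ[𝓝[>] 0]
      fun δ => δ ^ (-(n : ℝ) / 8) * meshIsingPlusCorr Ω δ a := by
    filter_upwards [hpos, self_mem_nhdsWithin] with δ hρ hδ
    have hδ' : (0 : ℝ) < δ := hδ
    rw [Real.mul_rpow (Real.rpow_nonneg hδ'.le _) hρ.le, ← Real.rpow_mul hδ'.le]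
    have h1 : rhoCHI δ ^ ((n : ℝ) / 2) * rhoCHI δ ^ (-(n : ℝ) / 2) = 1 := by
      rw [← Real.rpow_add hρ]
      have : (n : ℝ) / 2 + -(n : ℝ) / 2 = 0 := by ring
      rw [this, Real.rpow_zero]
    have h2 : (-(1 : ℝ) / 4) * ((n : ℝ) / 2) = -(n : ℝ) / 8 := by ring
    rw [h2]
    calc δ ^ (-(n : ℝ) / 8) * rhoCHI δ ^ ((n : ℝ) / 2) *
          (rhoCHI δ ^ (-(n : ℝ) / 2) * meshIsingPlusCorr Ω δ a)
        = δ ^ (-(n : ℝ) / 8) * (rhoCHI δ ^ ((n : ℝ) / 2) * rhoCHI δ ^ (-(n : ℝ) / 2)) *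
            meshIsingPlusCorr Ω δ a := by ring
      _ = δ ^ (-(n : ℝ) / 8) * meshIsingPlusCorr Ω δ a := by rw [h1, mul_one]
  have h₅ := h₄.congr' key
  have hC : (C₂ ^ ((1 : ℝ) / 2)) ^ n = C₂ ^ ((n : ℝ) / 2) := by
    rw [← Real.rpow_natCast, ← Real.rpow_mul hC₂.le]
    congr 1; ring
  rw [hC]
  exact h₅

/-- **crit-ising.S14, corrected form of `chi_conformal_invariance`** (CHI Thm 1.3 with (1.2) and
Remark 1.2 (iii)), as a theorem over the two named facts it combines: under `chi_multiPoint_rho`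
(CHI Thm 1.3, `ϱ`-normalised, with the covariance (1.2)) and `wu_rhoCHI` (Wu's asymptotics
`ϱ(δ) ∼ 𝒞₂ δ^{1/4}`, CHI Remark 1.2 (iii)) there are a conformally covariant family `S` (exponent
`1/8`) and a lattice constant `𝒞 > 0` (`𝒞 = C₂^{1/2}`, same family `S`) such that for every
admissible `Ω` **whose discretisations approximate it in CHI's sense** (`MeshApproximates Ω` — the
hypothesis `chi_conformal_invariance` omits; see the Erratum in `PlanarIsing.lean`) and all
distinct `a₁, …, aₙ ∈ Ω`, `δ^{-n/8} 𝔼⁺_{Ω_δ}[σ_{a₁} ⋯ σ_{aₙ}] → 𝒞ⁿ · S Ω n a` as `δ → 0⁺`.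
This is the `δ`-normalised reading CHI print on p. 3 ("our result …, when combined with the
asymptotics of the two-point correlations in the plane, reads as follows"), for all `n`.
Bookkeeping (D-0026 split review, 2026-08-15): until then this declaration was a named fact
`def chi_conformal_invariance_hausdorff : Prop` with exactly the conclusion below, discharged only
through the glue `chi_conformal_invariance_hausdorff_of : chi_multiPoint_rho → wu_rhoCHI → …`; being
a corollary of those two published results and not a third one, it is now that glue theorem itself
(statement of the conclusion unchanged), so the unproved content is carried by `chi_multiPoint_rho`
and `wu_rhoCHI` alone. [cite: ChelkakHonglerIzyurovAnnals2015, Thm. 1.3 with eq. (1.2) and Rem. 1.2 (iii); §1 p. 3 display] -/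
theorem chi_conformal_invariance_hausdorff (h₁ : chi_multiPoint_rho) (h₂ : wu_rhoCHI) :
    ∃ (S : PlanarCorrFamily) (C : ℝ), 0 < C ∧ IsConformallyCovariant (1 / 8) S ∧
      ∀ (Ω : Set ℂ), IsAdmissibleDomain Ω → MeshApproximates Ω → ∀ (n : ℕ) (a : Fin n → ℂ),
        Function.Injective a → (∀ i, a i ∈ Ω) →
          Tendsto (fun δ => δ ^ (-(n : ℝ) / 8) * meshIsingPlusCorr Ω δ a) (𝓝[>] 0)
            (𝓝 (C ^ n * S Ω n a)) := by
  obtain ⟨S, hS, h⟩ := h₁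
  obtain ⟨C₂, hC₂, hρ⟩ := h₂
  refine ⟨S, C₂ ^ ((1 : ℝ) / 2), by positivity, hS, ?_⟩
  intro Ω hΩ hM n a ha haΩ
  exact tendsto_multiPoint_of_rho (h Ω hΩ hM n a ha haΩ) hC₂ hρ

/-- Corrected form of `tendsto_chiPlusCorr`: under `chi_multiPoint_rho` (CHI Thm 1.3) and
`wu_rhoCHI` (CHI Rem. 1.2 (iii)), for an admissible `Ω` whose discretisations approximate it and
distinct marked points, the renormalised discrete correlations converge to `chiPlusCorr Ω n a`
(via `chi_conformal_invariance_hausdorff`).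
[cite: ChelkakHonglerIzyurovAnnals2015, Thm. 1.3 with Rem. 1.2 (iii)] -/
theorem tendsto_chiPlusCorr_of_hausdorff (h₁ : chi_multiPoint_rho) (h₂ : wu_rhoCHI) {Ω : Set ℂ}
    (hΩ : IsAdmissibleDomain Ω) (hM : MeshApproximates Ω) {n : ℕ} {a : Fin n → ℂ}
    (ha : Function.Injective a) (haΩ : ∀ i, a i ∈ Ω) :
    Tendsto (fun δ => δ ^ (-(n : ℝ) / 8) * meshIsingPlusCorr Ω δ a) (𝓝[>] 0)
      (𝓝 (chiPlusCorr Ω n a)) := by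
  obtain ⟨S, C, -, -, h⟩ := chi_conformal_invariance_hausdorff h₁ h₂
  exact tendsto_nhds_limUnder ⟨_, h Ω hΩ hM n a ha haΩ⟩

/-- Corrected form of `isConformallyCovariant_chiPlusCorr`: under `chi_multiPoint_rho` (CHI
Thm 1.3) and `wu_rhoCHI` (CHI Rem. 1.2 (iii)) the CHI limit family `chiPlusCorr` is conformally
covariant with exponent `1/8` **between admissible domains whose discretisations approximate
them** (via `chi_conformal_invariance_hausdorff` and uniqueness of limits: the constant `𝒞ⁿ` is the
same on both sides). (CHI Thm 1.3, eq. (1.2).)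
[cite: ChelkakHonglerIzyurovAnnals2015, Thm. 1.3 eq. (1.2)] -/
theorem chiPlusCorr_covariant_of_hausdorff (h₁ : chi_multiPoint_rho) (h₂ : wu_rhoCHI)
    {Ω Ω' : Set ℂ} {φ : ℂ → ℂ} (hΩ : IsAdmissibleDomain Ω) (hM : MeshApproximates Ω)
    (hΩ' : IsAdmissibleDomain Ω') (hM' : MeshApproximates Ω') (hφ : IsConformalBijection φ Ω Ω')
    {n : ℕ} {a : Fin n → ℂ} (ha : Function.Injective a) (haΩ : ∀ i, a i ∈ Ω) :
    chiPlusCorr Ω' n (fun i => φ (a i)) = (∏ i, ‖deriv φ (a i)‖ ^ (-(1 / 8 : ℝ))) * chiPlusCorr Ω n a := by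
  obtain ⟨S, C, -, hS, h⟩ := chi_conformal_invariance_hausdorff h₁ h₂
  have key : ∀ Ω, IsAdmissibleDomain Ω → MeshApproximates Ω → ∀ n (a : Fin n → ℂ),
      Function.Injective a → (∀ i, a i ∈ Ω) → chiPlusCorr Ω n a = C ^ n * S Ω n a :=
    fun Ω hΩ hM n a ha haΩ => (h Ω hΩ hM n a ha haΩ).limUnder_eq
  have ha' : Function.Injective fun i => φ (a i) :=
    fun i j hij => ha (hφ.2.injOn (haΩ i) (haΩ j) hij)
  rw [key Ω hΩ hM n a ha haΩ, key Ω' hΩ' hM' n _ ha' fun i => hφ.2.mapsTo (haΩ i),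
    hS Ω Ω' φ hΩ hΩ' hφ n a ha haΩ]
  ring

/-! ### From Wu's lattice form to `wu_rhoCHI` (D-0026 split review, 2026-08-15) -/

section WuGlue

/-- `(√2/2)/δ → +∞` as `δ → 0⁺`. [folklore] -/
private theorem tendsto_half_sqrt_two_div :
    Tendsto (fun δ : ℝ => Real.sqrt 2 / 2 / δ) (𝓝[>] 0) atTop := by
  have h := tendsto_inv_nhdsGT_zero.const_mul_atTop (show (0 : ℝ) < Real.sqrt 2 / 2 by positivity)
  refine h.congr' (Eventually.of_forall fun δ => ?_)
  simp [div_eq_mul_inv]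

/-- **`wu_rhoCHI` from Wu's theorem in its printed lattice form.** If the critical diagonal
two-point function of the plus state satisfies `N^{1/4} · ⟨σ_{(0,0)} σ_{(N,N)}⟩⁺_{β_c(2)} → A` for
some `A > 0` (T. T. Wu 1966; McCoy–Wu, *The two-dimensional Ising model* (1973), Ch. XI:
`⟨σ_{0,0}σ_{N,N}⟩ ∼ A N^{-1/4}`, `A = 2^{1/12} e^{3ζ'(-1)} ≈ 0.6450`), then CHI's normalising factor
obeys `δ^{-1/4} ϱ(δ) → C₂ := (√2/2)^{-1/4} A > 0` as `δ → 0⁺` (CHI Rem. 1.2 (iii)): indeed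
`ϱ(δ) = ⟨σ_{(0,0)} σ_{(N,N)}⟩⁺` with `N = round(1/(δ√2))` (`rhoCHI`, `nearestSite`), and
`δ · N → √2/2`. The hypothesis is deliberately a hypothesis (a reduction theorem, no named fact):
it is the statement an exact-solution derivation of the critical diagonal correlations must
deliver to discharge `wu_rhoCHI`. [cite: ChelkakHonglerIzyurovAnnals2015, §1.1 (definition of ϱ(δ)) and Rem. 1.2 (iii)] -/
theorem wu_rhoCHI_of_tendsto_diag
    (h : ∃ A : ℝ, 0 < A ∧
      Tendsto (fun N : ℕ => (N : ℝ) ^ ((1 : ℝ) / 4) * twoPointPlus 2 criticalBetaTwo ![(N : ℤ), (N : ℤ)])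
        atTop (𝓝 A)) :
    wu_rhoCHI := by
  obtain ⟨A, hA, hlim⟩ := h
  -- notation: `g δ = (√2/2)/δ`, `N δ = round (g δ) ∈ ℤ`, `n δ = (N δ).toNat`
  set g : ℝ → ℝ := fun δ => Real.sqrt 2 / 2 / δ with hg
  have hg_top : Tendsto g (𝓝[>] 0) atTop := tendsto_half_sqrt_two_div
  -- eventually `N δ ≥ 1`
  have hN_pos : ∀ᶠ δ in 𝓝[>] (0 : ℝ), (1 : ℤ) ≤ round (g δ) := by
    filter_upwards [hg_top.eventually (eventually_ge_atTop (3 / 2 : ℝ))] with δ hδ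
    have h1 := abs_sub_round (g δ)
    have h2 : (1 : ℝ) ≤ (round (g δ) : ℤ) := by
      have := (abs_le.1 h1).2
      linarith
    exact_mod_cast h2
  -- `n δ → ∞` in `ℕ`
  have hn_top : Tendsto (fun δ => (round (g δ)).toNat) (𝓝[>] (0 : ℝ)) atTop := by
    refine tendsto_atTop.2 fun b => ?_
    filter_upwards [hg_top.eventually (eventually_ge_atTop ((b : ℝ) + 1))] with δ hδ
    have h1 := abs_sub_round (g δ)
    have h2 : ((b : ℤ) : ℝ) ≤ (round (g δ) : ℤ) := by
      have := (abs_le.1 h1).2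
      push_cast at this ⊢
      linarith
    have h3 : (b : ℤ) ≤ round (g δ) := by exact_mod_cast h2
    omega
  -- the second factor: `N^{1/4} ⟨σσ⟩(N) → A` along `n δ`
  have h2nd := hlim.comp hn_top
  -- `δ · n δ → √2/2`
  have hδn : Tendsto (fun δ : ℝ => δ * ((round (g δ)).toNat : ℝ)) (𝓝[>] 0) (𝓝 (Real.sqrt 2 / 2)) := by
    have hδ0 : Tendsto (fun δ : ℝ => δ) (𝓝[>] 0) (𝓝 0) := tendsto_nhdsWithin_of_tendsto_nhds tendsto_id
    have hbound : ∀ᶠ δ in 𝓝[>] (0 : ℝ),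
        |δ * ((round (g δ)).toNat : ℝ) - Real.sqrt 2 / 2| ≤ |δ| * (1 / 2) := by
      filter_upwards [hN_pos, self_mem_nhdsWithin] with δ hN hδ
      have hδ' : (0 : ℝ) < δ := hδ
      have hcast : ((round (g δ)).toNat : ℝ) = ((round (g δ) : ℤ) : ℝ) := by
        have : ((round (g δ)).toNat : ℤ) = round (g δ) := Int.toNat_of_nonneg (by omega)
        exact_mod_cast this
      have hgδ : δ * g δ = Real.sqrt 2 / 2 := by
        simp only [hg]; field_simp
      have h1 := abs_sub_round (g δ)
      rw [hcast, show δ * ((round (g δ) : ℤ) : ℝ) - Real.sqrt 2 / 2 = δ * ((round (g δ) : ℤ) - g δ) by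
        rw [mul_sub, hgδ], abs_mul]
      gcongr
      rw [abs_sub_comm]; exact h1
    have hsmall : Tendsto (fun δ : ℝ => |δ| * (1 / 2)) (𝓝[>] 0) (𝓝 0) := by
      have := hδ0.abs.mul_const (1 / 2)
      rwa [abs_zero, zero_mul] at this
    rw [tendsto_iff_norm_sub_tendsto_zero]
    exact squeeze_zero' (Eventually.of_forall fun δ => norm_nonneg _) hbound hsmall
  -- hence `(δ n)^{-1/4} → (√2/2)^{-1/4}`
  have h1st : Tendsto (fun δ : ℝ => (δ * ((round (g δ)).toNat : ℝ)) ^ (-(1 : ℝ) / 4)) (𝓝[>] 0)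
      (𝓝 ((Real.sqrt 2 / 2) ^ (-(1 : ℝ) / 4))) :=
    hδn.rpow_const (Or.inl (by positivity))
  refine ⟨(Real.sqrt 2 / 2) ^ (-(1 : ℝ) / 4) * A, by positivity, ?_⟩
  refine (h1st.mul h2nd).congr' ?_
  filter_upwards [hN_pos, self_mem_nhdsWithin] with δ hN hδ
  have hδ' : (0 : ℝ) < δ := hδ
  have hn0 : (0 : ℝ) < ((round (g δ)).toNat : ℝ) := by
    have : 1 ≤ (round (g δ)).toNat := by omega
    exact_mod_cast this
  have hsite : nearestSite δ ⟨Real.sqrt 2 / 2, Real.sqrt 2 / 2⟩ =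
      ![((round (g δ)).toNat : ℤ), ((round (g δ)).toNat : ℤ)] := by
    have : ((round (g δ)).toNat : ℤ) = round (g δ) := Int.toNat_of_nonneg (by omega)
    rw [this]; rfl
  simp only [Function.comp_apply, rhoCHI, hsite]
  rw [Real.mul_rpow hδ'.le hn0.le]
  have hcancel : ((round (g δ)).toNat : ℝ) ^ (-(1 : ℝ) / 4) *
      ((round (g δ)).toNat : ℝ) ^ ((1 : ℝ) / 4) = 1 := by
    rw [← Real.rpow_add hn0]; norm_num
  calc δ ^ (-(1 : ℝ) / 4) * ((round (g δ)).toNat : ℝ) ^ (-(1 : ℝ) / 4) *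
        (((round (g δ)).toNat : ℝ) ^ ((1 : ℝ) / 4) *
          twoPointPlus 2 criticalBetaTwo ![((round (g δ)).toNat : ℤ), ((round (g δ)).toNat : ℤ)])
      = δ ^ (-(1 : ℝ) / 4) * (((round (g δ)).toNat : ℝ) ^ (-(1 : ℝ) / 4) *
          ((round (g δ)).toNat : ℝ) ^ ((1 : ℝ) / 4)) *
          twoPointPlus 2 criticalBetaTwo ![((round (g δ)).toNat : ℤ), ((round (g δ)).toNat : ℤ)] := by
        ring
    _ = δ ^ (-(1 : ℝ) / 4) *
          twoPointPlus 2 criticalBetaTwo ![((round (g δ)).toNat : ℤ), ((round (g δ)).toNat : ℤ)] := by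
        rw [hcancel, mul_one]

end WuGlue

end Literature.Probability.LatticeModels
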